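import Literature.MathematicalPhysics.QuantumFieldTheory.Balaban1983to89.Node00.Record13Co
import Literature.MathematicalPhysics.QuantumFieldTheory.Balaban1983to89.Node00.Record13CarriersSep

/-!
# NODE 00 (YM-PLAN Track A) — THE STAGE-13 CARRIER STACK AT PRINT'S BACKGROUND `U_k(V)` (node00-def-T's RECORD 13 Co edition `Node00/Record13Co`, director-ym №152 (β)):
# the Co Stage-5 view `toStage5₁₃Co` commutes with every `X`-re-binding and every pin (`rfl`), the Co CORE datum `datumOfRecord₁₃Co` is UP-SIDE (`rfl`), the Co CORE
# record `IsRecordOfRecord₁₃CCo` is presented at any re-bound ∕ [B10]- ∕ [B13]- ∕ X-pinned view, N10 is read at the C-binding of the [B13]-pinned Co view, and the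
# five cumulative Co VIEWS `view₁₃CoB10YZW ∕ view₁₃CoB8B10YZW ∕ view₁₃CoB12B8B10YZW ∕ view₁₃CoB8subB10YZW ∕ view₁₃CoB12B8subB10YZW` with their leaves by name — the
# EDITION-FREE carrier layer every Co ∕ SepCo consumer reads (seat `pub-ymgap-dag-n10-d` g8, the ₁₃ carriers' declarer of record — dag-lead WORDS-130; KEY-RULE-21 (R2)∕(R4) names)

NODE 00 RECORD MODULE at Stage 13, Co edition (node00-def-T g15 `Node00/Record13Co.lean` p515035 ✓ 08:40:58Z — RECORD 13 AT PRINT'S BACKGROUND: `UbgOfRecord₁₃Co`, the Co images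
`S218OfRecord₁₃Co ∕ SLaw₁₃Co ∕ TLaw₁₃Co ∕ VOfRecord₁₃Co ∕ residualOfStage13Co ∕ Stage13Params.toStage5₁₃Co ∕ coreOfRecord₁₃Co`, the tower ∕ datum `towerOfRecord₁₃Co ∕
datumOfRecord₁₃Co` keyed on the UNCHANGED background-free `Stage13Params.Provisos₁₃Core`, the record `IsRecordOfRecord₁₃CCo` (+ `isRecordOfRecord₁₃CCo_of_eq`,
`exists_world_isRecordOfRecord₁₃CCo`) — director-ym №149∕№150∕№152, def-R FILE 22 `UbgMSCoOfRecord`; KEY-RULE-21: (R2) first `₁₃ ↦ ₁₃Co`, (R4) `…₁₃CCore ↦ …₁₃CCo`) and this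
seat's `Node00/Record13Carriers` (p490901: θ-level `rebindX` ∕ pins, `WOfRecord₁₃` — background-free, reused), `…CarriersB13` (p491215: `pinB13`, `XB13OfRecord`), `…CarriersXPinned`
(p497764: `XPinned₁₃`, `pinX3`), `…CarriersSep` §1 (p502304: the CORE PINS `Provisos₁₃Core.rebindX ∕ .pin<G>` — background-free, reused, NOT re-declared).  WHY THIS LEAF (director
№152 §4 «key ONCE, on Core(Co)»; def-T g15 «Core family lands FIRST: key ONCE on Core where you read no proviso row»; dag-n24-c DESIGN-INPUT-CORE-N24): the U_old-keyed Stage-5 view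
`toStage5₁₃` reads the background through `residualOfStage13` (`V := VOfRecord₁₃`, `S218 := S218OfRecord₁₃`), so EVERY face of the carrier stack that binds a world's upstream
blocks (`w.up P = upOfRecord₅C F N (… .toStage5₁₃ …) P`), every cumulative view `((((θ.toStage5₁₃).pinB10).pinY …).pinZ …).pinW …` and every record presentation needs its Co
image before a Co ∕ SepCo-keyed consumer (dag-n24-c's K1 engine ⁵, the node storeys, dag-n22-e's layer B) can bind worlds at pinned views at print's background.  THIS LEAF = those
images, VERBATIM statements and proofs of the U_old faces under (R2)∕(R4): §1 `Stage13Params.toStage5₁₃Co_rebindX ∕ _pinB10 ∕ _pinY ∕ _pinZ ∕ _pinW ∕ _pinB8 ∕ _pinB12_pinB8Sub ∕ _pinB13 ∕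
_pinX3` (`rfl` ∕ instances), `SLaw₁₃Co_TLaw₁₃Co_rebindX`, `Stage13Params.pinX3_lawsCo`; §2 `datumOfRecord₁₃Co_rebindX ∕ _pin<G>` (ten; ALL `rfl` — UP-SIDE; key `h : θ.Provisos₁₃Core`
and its existing pins); §3 `isRecordOfRecord₁₃CCo_rebindX_of_eq ∕ _pinB10_of_eq ∕ _pinB13_of_eq ∕ _pinX3_of_eq`, `exists_world_isRecordOfRecord₁₃CCo_rebindX ∕ _pinX3`; §4 N10 at the
[B13]-pinned Co view `b13_main_iff_toStage5₁₃Co_pinB13 ∕ b13_main_at_toStage5₁₃Co_pinB13`; §5 the five Co views (definitions) with `view₁₃CoB10YZW_eq` and the leaves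
`upOfRecord₅C_view₁₃CoB10YZW_leaves`, `upOfRecord₅CS_view₁₃CoB8B10YZW_leaves ∕ …B12B8B10YZW… ∕ …B8subB10YZW… ∕ …B12B8subB10YZW…`, `upOfRecord₅C_view₁₃CoB8B10YZW_b8_iff ∕
…B8subB10YZW_b8_iff`.  The node leaves (`b8 ∕ b9 ∕ b10 ∕ b11 ∕ b12 ∕ b13 ∕ rBasicStep`) of a Co view are the SAME carriers' leaves as before — only `rOperation` and the
laws `SLaw ∕ TLaw` read the background.  APPEND-ONLY: a NEW importing leaf; nothing landed is edited; the U_old faces stand for the v1.1∕v1.2∕v1.3 siblings.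
[Balaban1988Convergent] = Commun. Math. Phys. **119** (1988) 243–285; [Balaban1989LargeFieldII] = Commun. Math. Phys. **122** (1989) 355–392.

HONEST FRAMING: definitions (five views, compositions of landed pins) + kernel bookkeeping (`rfl`, `Iff.rfl`, anonymous-constructor records); NO estimate; nothing of Bałaban's
asserted; no proviso inhabited; no node discharged; counts unmoved (typed 28∕28 · discharged 5∕27); one finite T⁴ programme at fixed ε — NOT continuum ∕ ℝ⁴ ∕ OS ∕ mass gap ∕
Clay.  No `sorry`, no `axiom`, no `instance`, no `notation`.
-/

noncomputable section

namespace Literature.MathematicalPhysics.QuantumFieldTheory.Balaban1983to89.Node00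

open T4Continuum AveragingRT T4FiniteEpsInhabited FlowStep FlowStepRuns DagBinding T4DatumAssembly
open B8LeafKnitRS (B8LeafRS)
open B15LeafKnitRepr (WOfRepr)
open scoped Matrix.Norms.L2Operator

variable (F : T4Family) (N : ℕ) [NeZero N]


/-! ## §1. The Co Stage-5 view `toStage5₁₃Co` commutes with every `X`-re-binding and every pin; the Co laws read no carrier -/

section Faces

/-- **The Stage-13 view commutes with re-binding `X`** (`rfl`, once, at a generic re-binding: `residualOfStage13`'s pinned fields read no carrier).
[cite: Balaban1988Convergent, p.244 (bookkeeping)] -/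
theorem Stage13Params.toStage5₁₃Co_rebindX (θ : Stage13Params F N) (X' : B12.RunParams → PrintedCarriersR) :
    (θ.rebindX F N X').toStage5₁₃Co F N = (θ.toStage5₁₃Co F N).rebindX F N X' := rfl

/-- The Stage-13 view of [B10]-pinned parameters IS the [B10]-pinned Stage-13 view (`rfl`). [cite: Balaban1985UV3, (1)–(5) p.256 (bookkeeping)] -/
theorem Stage13Params.toStage5₁₃Co_pinB10 (θ : Stage13Params F N) : (θ.pinB10 F N).toStage5₁₃Co F N = (θ.toStage5₁₃Co F N).pinB10 F N :=
  Stage13Params.toStage5₁₃Co_rebindX F N θ _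

/-- … Y (`rfl`) … [cite: Balaban1985BackgroundPropagators, Thm 3.1 p.397 (bookkeeping)] -/
theorem Stage13Params.toStage5₁₃Co_pinY (θ : Stage13Params F N) (Y₀ : PrintedCarriers9X) : (θ.pinY F N Y₀).toStage5₁₃Co F N = (θ.toStage5₁₃Co F N).pinY F N Y₀ := rfl

/-- … Z (`rfl`) … [cite: Balaban1985Variational, Thm 1 p.279 (bookkeeping)] -/
theorem Stage13Params.toStage5₁₃Co_pinZ (θ : Stage13Params F N) (Z₀ : PrintedCarriers11) : (θ.pinZ F N Z₀).toStage5₁₃Co F N = (θ.toStage5₁₃Co F N).pinZ F N Z₀ := rfl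

/-- … W (`rfl`) … [cite: Balaban1989LargeFieldI, (0.2) p.176 (bookkeeping)] -/
theorem Stage13Params.toStage5₁₃Co_pinW (θ : Stage13Params F N) (W₀ : B12.RunParams → PrintedCarriers15) :
    (θ.pinW F N W₀).toStage5₁₃Co F N = (θ.toStage5₁₃Co F N).pinW F N W₀ := rfl

/-- … [B8] (`rfl`) … [cite: Balaban1985RegularSpaces, Thm 2 p.83 (bookkeeping)] -/
theorem Stage13Params.toStage5₁₃Co_pinB8 (θ : Stage13Params F N) (lam : ResidB8 θ.toStage3Params) :
    (θ.pinB8 F N lam).toStage5₁₃Co F N = (θ.toStage5₁₃Co F N).pinB8 F N lam :=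
  Stage13Params.toStage5₁₃Co_rebindX F N θ _

/-- … [B12] and [B8′] (`rfl` ×2, through `toStage5₁₃Co_rebindX`). [cite: Balaban1988Convergent, p.244 (bookkeeping)] -/
theorem Stage13Params.toStage5₁₃Co_pinB12_pinB8Sub (θ : Stage13Params F N) (lam : ResidB12 F N θ.τ9.M) (lam8 : ResidB8 θ.toStage3Params) :
    (θ.pinB12 F N lam).toStage5₁₃Co F N = (θ.toStage5₁₃Co F N).rebindX F N (XB12OfRecord₁₂ F N θ.toStage12Params lam θ.res.X) ∧
    (θ.pinB8Sub F N lam8).toStage5₁₃Co F N = (θ.toStage5₁₃Co F N).rebindX F N (fun P => (θ.res.X P).withB8OfRecordSub θ.toStage3Params lam8) :=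
  ⟨Stage13Params.toStage5₁₃Co_rebindX F N θ _, Stage13Params.toStage5₁₃Co_rebindX F N θ _⟩

/-- The Stage-13 view of [B13]-pinned parameters IS the re-bound Stage-13 view (`Record13Carriers.Stage13Params.toStage5₁₃Co_rebindX`). [cite: Balaban1988Convergent, p.244 (bookkeeping)] -/
theorem Stage13Params.toStage5₁₃Co_pinB13 (θ : Stage13Params F N) (lam : B12.RunParams → ResidB13 θ.toStage3Params) :
    (θ.pinB13 F N lam).toStage5₁₃Co F N = (θ.toStage5₁₃Co F N).rebindX F N (XB13OfRecord θ.toStage3Params lam θ.res.X) :=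
  Stage13Params.toStage5₁₃Co_rebindX F N θ _

/-- The Stage-13 view of the pinned parameter IS the re-bound Stage-13 view (`toStage5₁₃Co_rebindX`). [cite: Balaban1988Convergent, p.244 (bookkeeping)] -/
theorem Stage13Params.toStage5₁₃Co_pinX3 (θ : Stage13Params F N) (lam8 : ResidB8 θ.toStage3Params) (lam12 : ResidB12 F N θ.τ9.M)
    (lam13 : B12.RunParams → ResidB13 θ.toStage3Params) :
    (θ.pinX3 F N lam8 lam12 lam13).toStage5₁₃Co F N = (θ.toStage5₁₃Co F N).rebindX F N (XPinned₁₃ F N θ lam8 lam12 lam13) :=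
  Stage13Params.toStage5₁₃Co_rebindX F N θ _

/-- … nor the §2-format law and the 𝐓-image law of record (`rfl` ×2). [cite: Balaban1988Convergent, (2.18) p.257, Thm 2 p.263 (bookkeeping)] -/
theorem SLaw₁₃Co_TLaw₁₃Co_rebindX (θ : Stage13Params F N) (X' : B12.RunParams → PrintedCarriersR) :
    SLaw₁₃Co F N (θ.rebindX F N X') = SLaw₁₃Co F N θ ∧ TLaw₁₃Co F N (θ.rebindX F N X') = TLaw₁₃Co F N θ := ⟨rfl, rfl⟩

/-- **The §2-format law and the 𝐓-image law AT PRINT'S BACKGROUND (`SLaw₁₃Co`, `TLaw₁₃Co`) do not read the carrier bundle either** — at the one-level X-pin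
(instances of `SLaw₁₃Co_TLaw₁₃Co_rebindX`; the five background-free objects are `pinX3_histories`'). [cite: Balaban1988Convergent, (2.18) p.257, Thm 2 p.263 (bookkeeping)] -/
theorem Stage13Params.pinX3_lawsCo (θ : Stage13Params F N) (lam8 : ResidB8 θ.toStage3Params) (lam12 : ResidB12 F N θ.τ9.M)
    (lam13 : B12.RunParams → ResidB13 θ.toStage3Params) :
    SLaw₁₃Co F N (θ.pinX3 F N lam8 lam12 lam13) = SLaw₁₃Co F N θ ∧ TLaw₁₃Co F N (θ.pinX3 F N lam8 lam12 lam13) = TLaw₁₃Co F N θ :=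
  ⟨(SLaw₁₃Co_TLaw₁₃Co_rebindX F N θ _).1, (SLaw₁₃Co_TLaw₁₃Co_rebindX F N θ _).2⟩

end Faces

/-! ## §2. The Co CORE datum `datumOfRecord₁₃Co` (key `h : θ.Provisos₁₃Core`) is UP-SIDE along every re-binding and pin (`rfl`) -/

section Datum

/-- **THE CORE-KEYED DATUM DOES NOT READ THE CARRIER BUNDLE `X`** (`rfl`, once, at a generic re-binding). [cite: Balaban1989LargeFieldII, Thm 1 + (0.1) pp.355–356 (bookkeeping)] -/
theorem datumOfRecord₁₃Co_rebindX (θ : Stage13Params F N) (h : θ.Provisos₁₃Core F N) (X' : B12.RunParams → PrintedCarriersR)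
    (h' : (θ.rebindX F N X').Provisos₁₃Core F N) : datumOfRecord₁₃Co F N (θ.rebindX F N X') h' = datumOfRecord₁₃Co F N θ h := rfl

/-- The [B10] pin is UP-SIDE at the core-keyed datum (`rfl`) … [cite: Balaban1989LargeFieldII, Thm 1 + (0.1) pp.355–356 (bookkeeping)] -/
theorem datumOfRecord₁₃Co_pinB10 (θ : Stage13Params F N) (h : θ.Provisos₁₃Core F N) :
    datumOfRecord₁₃Co F N (θ.pinB10 F N) h.pinB10 = datumOfRecord₁₃Co F N θ h :=
  datumOfRecord₁₃Co_rebindX F N θ h _ h.pinB10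

/-- … the Y pin (`rfl`) … [cite: Balaban1989LargeFieldII, Thm 1 + (0.1) pp.355–356 (bookkeeping)] -/
theorem datumOfRecord₁₃Co_pinY (θ : Stage13Params F N) (h : θ.Provisos₁₃Core F N) (Y₀ : PrintedCarriers9X) :
    datumOfRecord₁₃Co F N (θ.pinY F N Y₀) (h.pinY Y₀) = datumOfRecord₁₃Co F N θ h := rfl

/-- … the Z pin (`rfl`) … [cite: Balaban1989LargeFieldII, Thm 1 + (0.1) pp.355–356 (bookkeeping)] -/
theorem datumOfRecord₁₃Co_pinZ (θ : Stage13Params F N) (h : θ.Provisos₁₃Core F N) (Z₀ : PrintedCarriers11) :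
    datumOfRecord₁₃Co F N (θ.pinZ F N Z₀) (h.pinZ Z₀) = datumOfRecord₁₃Co F N θ h := rfl

/-- … the W pin (`rfl`) … [cite: Balaban1989LargeFieldII, Thm 1 + (0.1) pp.355–356 (bookkeeping)] -/
theorem datumOfRecord₁₃Co_pinW (θ : Stage13Params F N) (h : θ.Provisos₁₃Core F N) (W₀ : B12.RunParams → PrintedCarriers15) :
    datumOfRecord₁₃Co F N (θ.pinW F N W₀) (h.pinW W₀) = datumOfRecord₁₃Co F N θ h := rfl

/-- … the [B8] pin (`rfl`) … [cite: Balaban1989LargeFieldII, Thm 1 + (0.1) pp.355–356 (bookkeeping)] -/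
theorem datumOfRecord₁₃Co_pinB8 (θ : Stage13Params F N) (h : θ.Provisos₁₃Core F N) (lam : ResidB8 θ.toStage3Params) :
    datumOfRecord₁₃Co F N (θ.pinB8 F N lam) (h.pinB8 lam) = datumOfRecord₁₃Co F N θ h :=
  datumOfRecord₁₃Co_rebindX F N θ h _ (h.pinB8 lam)

/-- … the [B12] pin (`rfl`) … [cite: Balaban1989LargeFieldII, Thm 1 + (0.1) pp.355–356 (bookkeeping)] -/
theorem datumOfRecord₁₃Co_pinB12 (θ : Stage13Params F N) (h : θ.Provisos₁₃Core F N) (lam : ResidB12 F N θ.τ9.M) :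
    datumOfRecord₁₃Co F N (θ.pinB12 F N lam) (h.pinB12 lam) = datumOfRecord₁₃Co F N θ h :=
  datumOfRecord₁₃Co_rebindX F N θ h _ (h.pinB12 lam)

/-- … the [B8′] pin (`rfl`) … [cite: Balaban1989LargeFieldII, Thm 1 + (0.1) pp.355–356 (bookkeeping)] -/
theorem datumOfRecord₁₃Co_pinB8Sub (θ : Stage13Params F N) (h : θ.Provisos₁₃Core F N) (lam : ResidB8 θ.toStage3Params) :
    datumOfRecord₁₃Co F N (θ.pinB8Sub F N lam) (h.pinB8Sub lam) = datumOfRecord₁₃Co F N θ h :=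
  datumOfRecord₁₃Co_rebindX F N θ h _ (h.pinB8Sub lam)

/-- … the [B13] pin (`rfl`) … [cite: Balaban1989LargeFieldII, Thm 1 + (0.1) pp.355–356 (bookkeeping)] -/
theorem datumOfRecord₁₃Co_pinB13 (θ : Stage13Params F N) (h : θ.Provisos₁₃Core F N) (lam : B12.RunParams → ResidB13 θ.toStage3Params) :
    datumOfRecord₁₃Co F N (θ.pinB13 F N lam) (h.pinB13 lam) = datumOfRecord₁₃Co F N θ h :=
  datumOfRecord₁₃Co_rebindX F N θ h _ (h.pinB13 lam)

/-- … and the one-level X-pin (`rfl`). [cite: Balaban1989LargeFieldII, Thm 1 + (0.1) pp.355–356 (bookkeeping)] -/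
theorem datumOfRecord₁₃Co_pinX3 (θ : Stage13Params F N) (h : θ.Provisos₁₃Core F N) (lam8 : ResidB8 θ.toStage3Params) (lam12 : ResidB12 F N θ.τ9.M)
    (lam13 : B12.RunParams → ResidB13 θ.toStage3Params) :
    datumOfRecord₁₃Co F N (θ.pinX3 F N lam8 lam12 lam13) (h.pinX3 lam8 lam12 lam13) = datumOfRecord₁₃Co F N θ h :=
  datumOfRecord₁₃Co_rebindX F N θ h _ (h.pinX3 lam8 lam12 lam13)

end Datum

/-! ## §3. The Co CORE record `IsRecordOfRecord₁₃CCo` presented at a re-bound ∕ pinned Stage-13 view (same datum by §2) -/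

section Records

/-- **Pointed form, generic re-binding, Co-BACKGROUND CORE vocabulary**: a world with def-T's pointed clauses — construction `(datumOfRecord₁₃Co θ h).C`, window `0 < w.γ ≤ θ.γ`, block size
`θ.L` — whose upstream blocks are the C-binding over the Stage-13 view of the RE-BOUND parameters IS a Co-background ₁₃C record at `datumOfRecord₁₃Co θ h` (presenting parameter
`θ.rebindX X'`). [cite: Balaban1989LargeFieldII, Thm 1 + (0.1) pp.355–356 (bookkeeping)] -/
theorem isRecordOfRecord₁₃CCo_rebindX_of_eq (θ : Stage13Params F N) (h : θ.Provisos₁₃Core F N) (hθ : θ.Admissible F N) (X' : B12.RunParams → PrintedCarriersR)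
    (w : WorldP) (hC : w.C = (datumOfRecord₁₃Co F N θ h).C) (hγ : 0 < w.γ ∧ w.γ ≤ θ.γ) (hL : w.L = (θ.L : ℝ))
    (hup : ∀ P, w.up P = upOfRecord₅C F N ((θ.rebindX F N X').toStage5₁₃Co F N) P) :
    IsRecordOfRecord₁₃CCo F N (datumOfRecord₁₃Co F N θ h) w :=
  ⟨θ.rebindX F N X', h.rebindX X', (Stage13Params.rebindX_admissible_iff F N θ X').2 hθ, (datumOfRecord₁₃Co_rebindX F N θ h X' (h.rebindX X')).symm,
    hC, hγ, hL, hup⟩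

/-- **EVERY admissible Stage-13 parameter with the CORE provisos (print's background) presents a Co-background ₁₃C record at its own datum whose world is bound over ANY re-bound Stage-13 view**, any
window `0 < γw ≤ θ.γ`, block size `θ.L`. [cite: Balaban1989LargeFieldII, Thm 1 + (0.1) pp.355–356 (bookkeeping)] -/
theorem exists_world_isRecordOfRecord₁₃CCo_rebindX (θ : Stage13Params F N) (h : θ.Provisos₁₃Core F N) (hθ : θ.Admissible F N) (X' : B12.RunParams → PrintedCarriersR)
    {γw : ℝ} (hγw : 0 < γw ∧ γw ≤ θ.γ) :
    ∃ w : WorldP, IsRecordOfRecord₁₃CCo F N (datumOfRecord₁₃Co F N θ h) w ∧ w.γ = γw ∧ w.L = (θ.L : ℝ) ∧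
      ∀ P, w.up P = upOfRecord₅C F N ((θ.rebindX F N X').toStage5₁₃Co F N) P := by
  obtain ⟨w₀⟩ := nonempty_worldP
  exact ⟨{ w₀ with
      C := (datumOfRecord₁₃Co F N θ h).C, γ := γw, L := (θ.L : ℝ), one_lt_L := by exact_mod_cast θ.hL.2,
      up := fun P => upOfRecord₅C F N ((θ.rebindX F N X').toStage5₁₃Co F N) P },
    isRecordOfRecord₁₃CCo_rebindX_of_eq F N θ h hθ X' _ rfl hγw rfl (fun _ => rfl), rfl, rfl, fun _ => rfl⟩

/-- The [B10] instance (dag-n08-c's N08 ₁₃ storeys read it by name). [cite: Balaban1989LargeFieldII, Thm 1 + (0.1) pp.355–356; Balaban1985UV3, Thm 1 p.257 (bookkeeping)] -/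
theorem isRecordOfRecord₁₃CCo_pinB10_of_eq (θ : Stage13Params F N) (h : θ.Provisos₁₃Core F N) (hθ : θ.Admissible F N)
    (w : WorldP) (hC : w.C = (datumOfRecord₁₃Co F N θ h).C) (hγ : 0 < w.γ ∧ w.γ ≤ θ.γ) (hL : w.L = (θ.L : ℝ))
    (hup : ∀ P, w.up P = upOfRecord₅C F N ((θ.pinB10 F N).toStage5₁₃Co F N) P) :
    IsRecordOfRecord₁₃CCo F N (datumOfRecord₁₃Co F N θ h) w :=
  isRecordOfRecord₁₃CCo_rebindX_of_eq F N θ h hθ _ w hC hγ hL hup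

/-- The [B13] instance (this seat's N10 ₁₃ storeys read it by name). [cite: Balaban1989LargeFieldII, Thm 1 + (0.1) pp.355–356; Balaban1988RG2Cluster, Lemmas 1–3 pp.9–20 (bookkeeping)] -/
theorem isRecordOfRecord₁₃CCo_pinB13_of_eq (θ : Stage13Params F N) (h : θ.Provisos₁₃Core F N) (hθ : θ.Admissible F N)
    (lam : B12.RunParams → ResidB13 θ.toStage3Params) (w : WorldP) (hC : w.C = (datumOfRecord₁₃Co F N θ h).C) (hγ : 0 < w.γ ∧ w.γ ≤ θ.γ) (hL : w.L = (θ.L : ℝ))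
    (hup : ∀ P, w.up P = upOfRecord₅C F N ((θ.pinB13 F N lam).toStage5₁₃Co F N) P) :
    IsRecordOfRecord₁₃CCo F N (datumOfRecord₁₃Co F N θ h) w :=
  isRecordOfRecord₁₃CCo_rebindX_of_eq F N θ h hθ _ w hC hγ hL hup

/-- The X-pinned instance (dag-n24-c's K1 engine closers read it by name). [cite: Balaban1989LargeFieldII, Thm 1 + (0.1) pp.355–356 (bookkeeping)] -/
theorem isRecordOfRecord₁₃CCo_pinX3_of_eq (θ : Stage13Params F N) (h : θ.Provisos₁₃Core F N) (hθ : θ.Admissible F N) (lam8 : ResidB8 θ.toStage3Params)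
    (lam12 : ResidB12 F N θ.τ9.M) (lam13 : B12.RunParams → ResidB13 θ.toStage3Params) (w : WorldP) (hC : w.C = (datumOfRecord₁₃Co F N θ h).C)
    (hγ : 0 < w.γ ∧ w.γ ≤ θ.γ) (hL : w.L = (θ.L : ℝ)) (hup : ∀ P, w.up P = upOfRecord₅C F N ((θ.pinX3 F N lam8 lam12 lam13).toStage5₁₃Co F N) P) :
    IsRecordOfRecord₁₃CCo F N (datumOfRecord₁₃Co F N θ h) w :=
  isRecordOfRecord₁₃CCo_rebindX_of_eq F N θ h hθ _ w hC hγ hL hup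

/-- Every admissible Stage-13 parameter with the CORE provisos (print's background) presents a Co-background ₁₃C record of its own datum over the X-pinned Stage-13 view, any window `0 < γw ≤ θ.γ`,
block size `θ.L`. [cite: Balaban1989LargeFieldII, Thm 1 + (0.1) pp.355–356 (bookkeeping)] -/
theorem exists_world_isRecordOfRecord₁₃CCo_pinX3 (θ : Stage13Params F N) (h : θ.Provisos₁₃Core F N) (hθ : θ.Admissible F N) (lam8 : ResidB8 θ.toStage3Params)
    (lam12 : ResidB12 F N θ.τ9.M) (lam13 : B12.RunParams → ResidB13 θ.toStage3Params) {γw : ℝ} (hγw : 0 < γw ∧ γw ≤ θ.γ) :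
    ∃ w : WorldP, IsRecordOfRecord₁₃CCo F N (datumOfRecord₁₃Co F N θ h) w ∧ w.γ = γw ∧ w.L = (θ.L : ℝ) ∧
      ∀ P, w.up P = upOfRecord₅C F N ((θ.pinX3 F N lam8 lam12 lam13).toStage5₁₃Co F N) P :=
  exists_world_isRecordOfRecord₁₃CCo_rebindX F N θ h hθ _ hγw

end Records

/-! ## §4. N10 at a run bound to the C-binding of the [B13]-pinned Co view -/

section Pin13

variable {F N}

/-- **N10 AT A RUN BOUND TO THE C-BINDING OF THE [B13]-PINNED STAGE-13 VIEW** (`CarriersB13.b13_main_iff_rebindX_XB13OfRecord` at `φ := θ.toStage5₁₃Co`, through `toStage5₁₃Co_pinB13`):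
«b9 → b10 → b11 → b12 → b13» with `b13` THE LEAF AT THE GROUP OF RECORD, the in-edges at `θ`'s (residual) carriers `res.Y ∕ res.X ∕ res.Z` (the Stage-13 view keeps them, `rfl`).
[cite: Balaban1988RG2Cluster, Lemmas 1–3 pp.9, 11, 20 (the node at the objects of record)] -/
theorem b13_main_iff_toStage5₁₃Co_pinB13 (θ : Stage13Params F N) (lam : B12.RunParams → ResidB13 θ.toStage3Params) (w : WorldP) (P : B12.RunParams)
    (hup : w.up P = upOfRecord₅C F N ((θ.pinB13 F N lam).toStage5₁₃Co F N) P) :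
    Dag.B13_main (leavesP w P) ↔
      (B9LeafX (θ.res.Y P) → (B10.Thm1PrintedCompact (θ.res.X P).runs10 ∧ B10.Thm2Printed (θ.res.X P).runs10) → B11Leaf (θ.res.Z P) →
        B12Sec2to5.Lemma4Printed (θ.res.X P).F12 (θ.res.X P).c12 → B13LeafOfRecord θ.toStage3Params (lam P)) := by
  rw [Stage13Params.toStage5₁₃Co_pinB13] at hup
  exact b13_main_iff_rebindX_XB13OfRecord (θ.toStage5₁₃Co F N) lam θ.res.X w P hup

/-- **N10 AT `(w, P)` FROM THE TORUS LEAF TRIPLE AT THE STEP OF RECORD, at the C-binding of the [B13]-pinned Stage-13 view** (`CarriersB13.b13_main_at_rebindX_XB13OfRecord` at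
`φ := θ.toStage5₁₃Co`). [cite: Balaban1988RG2Cluster, Lemma 1 p.9, Lemma 2 p.11, Lemma 3 p.20] -/
theorem b13_main_at_toStage5₁₃Co_pinB13 (θ : Stage13Params F N) (lam : B12.RunParams → ResidB13 θ.toStage3Params) (w : WorldP) (P : B12.RunParams)
    (hup : w.up P = upOfRecord₅C F N ((θ.pinB13 F N lam).toStage5₁₃Co F N) P)
    (hleaf : B9LeafX (θ.res.Y P) → (B10.Thm1PrintedCompact (θ.res.X P).runs10 ∧ B10.Thm2Printed (θ.res.X P).runs10) → B11Leaf (θ.res.Z P) →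
      B12Sec2to5.Lemma4Printed (θ.res.X P).F12 (θ.res.X P).c12 →
        B13.Lemma1Printed (WtOfRecord θ.toStage3Params (lam P)).toStepData (c13OfRecord θ.toStage3Params (lam P)) ∧
          B13.Lemma2Printed (WtOfRecord θ.toStage3Params (lam P)).toStepData (c13OfRecord θ.toStage3Params (lam P)) ∧
            B13.Lemma3Printed (WtOfRecord θ.toStage3Params (lam P)).toStepData (c13OfRecord θ.toStage3Params (lam P))) :
    Dag.B13_main (leavesP w P) := by
  rw [Stage13Params.toStage5₁₃Co_pinB13] at hup
  exact b13_main_at_rebindX_XB13OfRecord (θ.toStage5₁₃Co F N) lam θ.res.X w P hup hleaf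

end Pin13

/-! ## §5. The five cumulative Co VIEWS (definitions) with their leaves by name -/

section Views

/-- **The cumulative four-pin Stage-13 view**: `θ.toStage5₁₃Co` pinned by `pinB10`, then `pinY (Y9OfRecord …)`, then `pinZ (Z11OfRecord F N ζ)`, then `pinW (WOfRecord₁₃ θ lamW)`.
[cite: Balaban1985UV3, Thm 1 p.257; Balaban1985BackgroundPropagators, Thm 3.1 p.397; Balaban1985Variational, Thm 1 p.279; Balaban1989LargeFieldI, (0.2) p.176 (objects of record)] -/
def Stage13Params.view₁₃CoB10YZW (θ : Stage13Params F N) (Mstar : ℕ) (ops : OpsY N θ.toStage3Params Mstar) (ζ : ResidZ F N) (lamW : ResidW F N) :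
    Stage5Params F N :=
  ((((θ.toStage5₁₃Co F N).pinB10 F N).pinY F N (Y9OfRecord N θ.toStage3Params Mstar ops)).pinZ F N (Z11OfRecord F N ζ)).pinW F N (WOfRecord₁₃ F N θ lamW)

/-- The four-pin view IS the Stage-13 view of the QUADRUPLY PINNED parameters (composed from the single-pin `rfl`s). [cite: Balaban1989LargeFieldII, Thm 1 p.355 (bookkeeping)] -/
theorem Stage13Params.view₁₃CoB10YZW_eq (θ : Stage13Params F N) (Mstar : ℕ) (ops : OpsY N θ.toStage3Params Mstar) (ζ : ResidZ F N) (lamW : ResidW F N) :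
    θ.view₁₃CoB10YZW F N Mstar ops ζ lamW =
      ((((θ.pinB10 F N).pinY F N (Y9OfRecord N θ.toStage3Params Mstar ops)).pinZ F N (Z11OfRecord F N ζ)).pinW F N (WOfRecord₁₃ F N θ lamW)).toStage5₁₃Co F N := by
  rw [Stage13Params.toStage5₁₃Co_pinW, Stage13Params.toStage5₁₃Co_pinZ, Stage13Params.toStage5₁₃Co_pinY, Stage13Params.toStage5₁₃Co_pinB10]
  rfl

/-- The leaves of the C-binding over the four-pin view, by name. [cite: Balaban1989LargeFieldI, Prop. 1 p.194; Balaban1985Variational, Thm 1 p.279; Balaban1985BackgroundPropagators, Thm 3.1 p.397; Balaban1985UV3, Thm 1 p.257 + Thm 2 p.272] -/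
theorem upOfRecord₅C_view₁₃CoB10YZW_leaves (θ : Stage13Params F N) (Mstar : ℕ) (ops : OpsY N θ.toStage3Params Mstar) (ζ : ResidZ F N) (lamW : ResidW F N) (P : B12.RunParams) :
    ((upOfRecord₅C F N (θ.view₁₃CoB10YZW F N Mstar ops ζ lamW) P).rBasicStep ↔ B15Leaf (WOfRecord₁₃ F N θ lamW P)) ∧
    ((upOfRecord₅C F N (θ.view₁₃CoB10YZW F N Mstar ops ζ lamW) P).b9 ↔ B9LeafX (Y9OfRecord N θ.toStage3Params Mstar ops)) ∧
    ((upOfRecord₅C F N (θ.view₁₃CoB10YZW F N Mstar ops ζ lamW) P).b10 ↔ PrintedUV3V N θ.L) ∧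
    ((upOfRecord₅C F N (θ.view₁₃CoB10YZW F N Mstar ops ζ lamW) P).b11 ↔ B11Leaf (Z11OfRecord F N ζ)) := by
  have hw := upOfRecord₅C_pinW_b9_b10_b11 F N ((((θ.toStage5₁₃Co F N).pinB10 F N).pinY F N (Y9OfRecord N θ.toStage3Params Mstar ops)).pinZ F N (Z11OfRecord F N ζ))
    (WOfRecord₁₃ F N θ lamW) P
  refine ⟨upOfRecord₅C_pinW_rBasicStep_iff F N _ _ P, ?_, ?_, ?_⟩
  · unfold Stage13Params.view₁₃CoB10YZW
    rw [hw.1, upOfRecord₅C_pinZ_b9]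
    exact upOfRecord₅C_pinY_b9_iff F N _ _ P
  · unfold Stage13Params.view₁₃CoB10YZW
    rw [hw.2.1, upOfRecord₅C_pinZ_b10, upOfRecord₅C_pinY_b10]
    exact upOfRecord₅C_pinB10_b10_iff F N (θ.toStage5₁₃Co F N) P
  · unfold Stage13Params.view₁₃CoB10YZW
    rw [hw.2.2]
    exact upOfRecord₅C_pinZ_b11_iff F N _ _ P

/-- **The five-pin Stage-13 view with [B8]** ([B8] innermost). [cite: Balaban1985RegularSpaces, Thm 2 p.83 (objects of record)] -/
def Stage13Params.view₁₃CoB8B10YZW (θ : Stage13Params F N) (lam : ResidB8 θ.toStage3Params) (Mstar : ℕ) (ops : OpsY N θ.toStage3Params Mstar) (ζ : ResidZ F N)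
    (lamW : ResidW F N) : Stage5Params F N :=
  (θ.pinB8 F N lam).view₁₃CoB10YZW F N Mstar ops ζ lamW

/-- The leaves of the S-binding over the five-pin view, by name (`b8` is `Iff.rfl`; the other four are the four-pin faces at `θ.pinB8 lam`).
[cite: Balaban1985RegularSpaces, Lemma 1 – Thm 8 pp.79–101; Balaban1989LargeFieldI, Prop. 1 p.194; Balaban1985BackgroundPropagators, Thm 3.1 p.397; Balaban1985UV3, Thm 1 p.257; Balaban1985Variational, Thm 1 p.279] -/
theorem upOfRecord₅CS_view₁₃CoB8B10YZW_leaves (θ : Stage13Params F N) (lam : ResidB8 θ.toStage3Params) (Mstar : ℕ) (ops : OpsY N θ.toStage3Params Mstar)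
    (ζ : ResidZ F N) (lamW : ResidW F N) (P : B12.RunParams) :
    ((upOfRecord₅CS F N (θ.view₁₃CoB8B10YZW F N lam Mstar ops ζ lamW) P).b8 ↔ B8LeafOfRecord θ.toStage3Params lam) ∧
    ((upOfRecord₅CS F N (θ.view₁₃CoB8B10YZW F N lam Mstar ops ζ lamW) P).rBasicStep ↔ B15Leaf (WOfRecord₁₃ F N θ lamW P)) ∧
    ((upOfRecord₅CS F N (θ.view₁₃CoB8B10YZW F N lam Mstar ops ζ lamW) P).b9 ↔ B9LeafX (Y9OfRecord N θ.toStage3Params Mstar ops)) ∧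
    ((upOfRecord₅CS F N (θ.view₁₃CoB8B10YZW F N lam Mstar ops ζ lamW) P).b10 ↔ PrintedUV3V N θ.L) ∧
    ((upOfRecord₅CS F N (θ.view₁₃CoB8B10YZW F N lam Mstar ops ζ lamW) P).b11 ↔ B11Leaf (Z11OfRecord F N ζ)) :=
  ⟨Iff.rfl, upOfRecord₅C_view₁₃CoB10YZW_leaves F N (θ.pinB8 F N lam) Mstar ops ζ lamW P⟩

/-- … and the C-binding's `b8` over the five-pin view is the leaf AS TYPED at the group of record (`Iff.rfl`). [cite: Balaban1985RegularSpaces, Lemma 1 – Thm 8 pp.79–101 (bookkeeping)] -/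
theorem upOfRecord₅C_view₁₃CoB8B10YZW_b8_iff (θ : Stage13Params F N) (lam : ResidB8 θ.toStage3Params) (Mstar : ℕ) (ops : OpsY N θ.toStage3Params Mstar)
    (ζ : ResidZ F N) (lamW : ResidW F N) (P : B12.RunParams) :
    (upOfRecord₅C F N (θ.view₁₃CoB8B10YZW F N lam Mstar ops ζ lamW) P).b8 ↔
      B8LeafR θ.D (θ.L : ℝ) lam.C₂ lam.B₁' lam.inp.B₀' lam.B₁ lam.B₂ lam.c₁ lam.inp lam.B₀β (B8Lemma1NonAbelian.blockPairNA θ.D θ.L θ.𝔸)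
        (famB8OfRecord θ.toStage3Params lam.β lam.len) lam.lan lam.cub lam.toAxial :=
  Iff.rfl

/-- **The six-pin Stage-13 view** ([B12] innermost, then the five-pin view with [B8]). [cite: Balaban1987RG1, Lemma 4 p.280; Balaban1985RegularSpaces, Thm 2 p.83 (objects of record)] -/
def Stage13Params.view₁₃CoB12B8B10YZW (θ : Stage13Params F N) (lam12 : ResidB12 F N θ.τ9.M) (lam : ResidB8 θ.toStage3Params) (Mstar : ℕ)
    (ops : OpsY N θ.toStage3Params Mstar) (ζ : ResidZ F N) (lamW : ResidW F N) : Stage5Params F N :=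
  (θ.pinB12 F N lam12).view₁₃CoB8B10YZW F N lam Mstar ops ζ lamW

/-- **The five-pin Stage-13 view with [B8′]** ([B8′] innermost). [cite: Balaban1985RegularSpaces, Thm 2 p.83 (objects of record)] -/
def Stage13Params.view₁₃CoB8subB10YZW (θ : Stage13Params F N) (lam : ResidB8 θ.toStage3Params) (Mstar : ℕ) (ops : OpsY N θ.toStage3Params Mstar) (ζ : ResidZ F N)
    (lamW : ResidW F N) : Stage5Params F N :=
  (θ.pinB8Sub F N lam).view₁₃CoB10YZW F N Mstar ops ζ lamW

/-- **The six-pin Stage-13 view with [B12] and [B8′]** ([B12] innermost). [cite: Balaban1987RG1, Lemma 4 p.280; Balaban1985RegularSpaces, Thm 2 p.83 (objects of record)] -/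
def Stage13Params.view₁₃CoB12B8subB10YZW (θ : Stage13Params F N) (lam12 : ResidB12 F N θ.τ9.M) (lam : ResidB8 θ.toStage3Params) (Mstar : ℕ)
    (ops : OpsY N θ.toStage3Params Mstar) (ζ : ResidZ F N) (lamW : ResidW F N) : Stage5Params F N :=
  (θ.pinB12 F N lam12).view₁₃CoB8subB10YZW F N lam Mstar ops ζ lamW

/-- **THE SIX LEAVES OF THE S-BINDING OVER THE SIX-PIN VIEW**, by name (`b12`, `b8` by `Iff.rfl`; the [B12] leaf is the Stage-12 one at `θ.toStage12Params`). [cite: Balaban1987RG1, Lemma 4 p.280; Balaban1985RegularSpaces, Lemma 1 – Thm 8 pp.79–101; Balaban1989LargeFieldI, Prop. 1 p.194; Balaban1985BackgroundPropagators, Thm 3.1 p.397; Balaban1985UV3, Thm 1 p.257; Balaban1985Variational, Thm 1 p.279] -/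
theorem upOfRecord₅CS_view₁₃CoB12B8B10YZW_leaves (θ : Stage13Params F N) (lam12 : ResidB12 F N θ.τ9.M) (lam : ResidB8 θ.toStage3Params) (Mstar : ℕ)
    (ops : OpsY N θ.toStage3Params Mstar) (ζ : ResidZ F N) (lamW : ResidW F N) (P : B12.RunParams) :
    ((upOfRecord₅CS F N (θ.view₁₃CoB12B8B10YZW F N lam12 lam Mstar ops ζ lamW) P).b12 ↔ B12LeafOfRecord₁₂ F N θ.toStage12Params lam12 P) ∧
    ((upOfRecord₅CS F N (θ.view₁₃CoB12B8B10YZW F N lam12 lam Mstar ops ζ lamW) P).b8 ↔ B8LeafOfRecord θ.toStage3Params lam) ∧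
    ((upOfRecord₅CS F N (θ.view₁₃CoB12B8B10YZW F N lam12 lam Mstar ops ζ lamW) P).rBasicStep ↔ B15Leaf (WOfRecord₁₃ F N θ lamW P)) ∧
    ((upOfRecord₅CS F N (θ.view₁₃CoB12B8B10YZW F N lam12 lam Mstar ops ζ lamW) P).b9 ↔ B9LeafX (Y9OfRecord N θ.toStage3Params Mstar ops)) ∧
    ((upOfRecord₅CS F N (θ.view₁₃CoB12B8B10YZW F N lam12 lam Mstar ops ζ lamW) P).b10 ↔ PrintedUV3V N θ.L) ∧
    ((upOfRecord₅CS F N (θ.view₁₃CoB12B8B10YZW F N lam12 lam Mstar ops ζ lamW) P).b11 ↔ B11Leaf (Z11OfRecord F N ζ)) :=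
  ⟨Iff.rfl, upOfRecord₅CS_view₁₃CoB8B10YZW_leaves F N (θ.pinB12 F N lam12) lam Mstar ops ζ lamW P⟩

/-- The leaves of the S-binding over the five-pin view with [B8′], by name (`b8` is `Iff.rfl`). [cite: Balaban1985RegularSpaces, Lemma 1 – Thm 8 pp.79–101; Balaban1989LargeFieldI, Prop. 1 p.194; Balaban1985BackgroundPropagators, Thm 3.1 p.397; Balaban1985UV3, Thm 1 p.257; Balaban1985Variational, Thm 1 p.279] -/
theorem upOfRecord₅CS_view₁₃CoB8subB10YZW_leaves (θ : Stage13Params F N) (lam : ResidB8 θ.toStage3Params) (Mstar : ℕ) (ops : OpsY N θ.toStage3Params Mstar)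
    (ζ : ResidZ F N) (lamW : ResidW F N) (P : B12.RunParams) :
    ((upOfRecord₅CS F N (θ.view₁₃CoB8subB10YZW F N lam Mstar ops ζ lamW) P).b8 ↔ B8LeafOfRecordSub θ.toStage3Params lam) ∧
    ((upOfRecord₅CS F N (θ.view₁₃CoB8subB10YZW F N lam Mstar ops ζ lamW) P).rBasicStep ↔ B15Leaf (WOfRecord₁₃ F N θ lamW P)) ∧
    ((upOfRecord₅CS F N (θ.view₁₃CoB8subB10YZW F N lam Mstar ops ζ lamW) P).b9 ↔ B9LeafX (Y9OfRecord N θ.toStage3Params Mstar ops)) ∧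
    ((upOfRecord₅CS F N (θ.view₁₃CoB8subB10YZW F N lam Mstar ops ζ lamW) P).b10 ↔ PrintedUV3V N θ.L) ∧
    ((upOfRecord₅CS F N (θ.view₁₃CoB8subB10YZW F N lam Mstar ops ζ lamW) P).b11 ↔ B11Leaf (Z11OfRecord F N ζ)) :=
  ⟨Iff.rfl, upOfRecord₅C_view₁₃CoB10YZW_leaves F N (θ.pinB8Sub F N lam) Mstar ops ζ lamW P⟩

/-- … and the C-binding's `b8` over it is the leaf AS TYPED at the re-keyed group of record (`Iff.rfl`). [cite: Balaban1985RegularSpaces, Lemma 1 – Thm 8 pp.79–101 (bookkeeping)] -/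
theorem upOfRecord₅C_view₁₃CoB8subB10YZW_b8_iff (θ : Stage13Params F N) (lam : ResidB8 θ.toStage3Params) (Mstar : ℕ) (ops : OpsY N θ.toStage3Params Mstar)
    (ζ : ResidZ F N) (lamW : ResidW F N) (P : B12.RunParams) :
    (upOfRecord₅C F N (θ.view₁₃CoB8subB10YZW F N lam Mstar ops ζ lamW) P).b8 ↔
      B8LeafR θ.D (θ.L : ℝ) lam.C₂ lam.B₁' lam.inp.B₀' lam.B₁ lam.B₂ lam.c₁ lam.inp lam.B₀β (B8Lemma1NonAbelian.blockPairNA θ.D θ.L θ.𝔸)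
        (fun j : IdxB8Sub θ.toStage3Params => famB8OfRecord θ.toStage3Params lam.β lam.len j.1) lam.lan lam.cub (fun j => lam.toAxial j.1) :=
  Iff.rfl

/-- **THE SIX LEAVES OF THE S-BINDING OVER THE SIX-PIN VIEW WITH [B8′]**, by name (`b12`, `b8` by `Iff.rfl`). [cite: Balaban1987RG1, Lemma 4 p.280; Balaban1985RegularSpaces, Lemma 1 – Thm 8 pp.79–101; Balaban1989LargeFieldI, Prop. 1 p.194; Balaban1985BackgroundPropagators, Thm 3.1 p.397; Balaban1985UV3, Thm 1 p.257; Balaban1985Variational, Thm 1 p.279] -/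
theorem upOfRecord₅CS_view₁₃CoB12B8subB10YZW_leaves (θ : Stage13Params F N) (lam12 : ResidB12 F N θ.τ9.M) (lam : ResidB8 θ.toStage3Params) (Mstar : ℕ)
    (ops : OpsY N θ.toStage3Params Mstar) (ζ : ResidZ F N) (lamW : ResidW F N) (P : B12.RunParams) :
    ((upOfRecord₅CS F N (θ.view₁₃CoB12B8subB10YZW F N lam12 lam Mstar ops ζ lamW) P).b12 ↔ B12LeafOfRecord₁₂ F N θ.toStage12Params lam12 P) ∧
    ((upOfRecord₅CS F N (θ.view₁₃CoB12B8subB10YZW F N lam12 lam Mstar ops ζ lamW) P).b8 ↔ B8LeafOfRecordSub θ.toStage3Params lam) ∧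
    ((upOfRecord₅CS F N (θ.view₁₃CoB12B8subB10YZW F N lam12 lam Mstar ops ζ lamW) P).rBasicStep ↔ B15Leaf (WOfRecord₁₃ F N θ lamW P)) ∧
    ((upOfRecord₅CS F N (θ.view₁₃CoB12B8subB10YZW F N lam12 lam Mstar ops ζ lamW) P).b9 ↔ B9LeafX (Y9OfRecord N θ.toStage3Params Mstar ops)) ∧
    ((upOfRecord₅CS F N (θ.view₁₃CoB12B8subB10YZW F N lam12 lam Mstar ops ζ lamW) P).b10 ↔ PrintedUV3V N θ.L) ∧
    ((upOfRecord₅CS F N (θ.view₁₃CoB12B8subB10YZW F N lam12 lam Mstar ops ζ lamW) P).b11 ↔ B11Leaf (Z11OfRecord F N ζ)) :=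
  ⟨Iff.rfl, upOfRecord₅CS_view₁₃CoB8subB10YZW_leaves F N (θ.pinB12 F N lam12) lam Mstar ops ζ lamW P⟩

end Views

end Literature.MathematicalPhysics.QuantumFieldTheory.Balaban1983to89.Node00

end
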